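import Literature.MathematicalPhysics.QuantumFieldTheory.Balaban1983to89.B5G183RateW1BlockC

/-!
# Bałaban [CMP 95 (1984)] (1.83)/(1.89) at `U = 1`: the RANK-ONE PIECE `T` of the order-two eta-rate in
the currency `W∂_ν ⊗ W∂_{ν′}` has the full rate — hence `OrderTwoOpRateResidualW1 d a C 1` HOLDS

HONEST FRAMING (cell `pub-balaban`, T⁴ programme, estimate NE2 = U1a «η-rate, linear theory»).  Finite
torus, lattice spacing `η = 1/n`, trivial background `U = 1`, one nonzero reduced momentum `p′ = s` at a
time, `ℓ²`-operator norm on the alias classes `× Fin d`.  Nothing here is about infinite volume, `U ≠ 1`,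
a mass gap, or any summit statement.  Bałaban prints NO rate; the currency (ONE King (4.20) alias weight
`W` on each lattice derivative), King's pairing `ι`/`plant` and every constant are OURS ([folklore]).

WHAT IS PRINTED.  [Balaban1984PropagatorsI] p. 31 (1.83): the third term of `G(p′)`, the rank-one
`a⁻¹(Σ_λ|∂_{1,λ}|²φ_λ⁻¹)⁻¹ b ⊗ b̄` with the brackets `b` of (1.88) p. 32 and «This factor multiplying the
function between the square bracket expressions gives an inverse of the expression (1.86)» (p. 32; the
«additional factor Δ₀²» regularisation: coefficient `cB = Δ₀²/(aσ)`, vectors `bR = b/Δ₀`); p. 33: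
«Proposition 1.1. The operator G is a symmetric operator on L²(T_η) and ‖GJ‖, ‖∇GJ‖, ‖G∇*J‖, ‖∇G∇*J‖,
‖∇∇GJ‖, ‖G∇*∇*J‖ ≤ γ₀⁻¹‖J‖, (1.89)».  [King1986] p. 672 (4.19)–(4.20) (`|u(p′+l)| ≤ Π_μ|p′_μ||p′_μ+l_μ|⁻¹`),
«To analyze the m = 0 term in (4.19), we successively replace each factor by the corresponding one … and
bound the error. We must always be careful to keep enough negative powers of momentum so that» the alias
sums converge; p. 673 (4.24), «So keeping γ + α < 1, the error produced by the above replacement is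
bounded by CL^{−γk}.»  (renders ref1 p015–p017, king p024/p025 read as images by this seat.)

WHAT THIS MODULE PROVES (kernel, [folklore]).  The FIFTH (last) piece difference of
`B5G183RatePieces.residual_eq_pieces` for the typed residual `B5G183RateO2Op.OrderTwoOpRateResidualW1`,
and the residual itself:
 §1 `bRw` (the regularised weighted bracket vector `(K,μ) ↦ w(K)·bR_μ(q̃_K)`), **`rankOne_bw_eq`**
    (b05's rank-one piece of Bałaban's fibre `= cB · bRw ⊗ bRw̄`, `B5G183Rate.fiber_rankOne_eq`);
 §2 `sum_sq_bRw_le` (`|bRw|₂² ≤ d·Bsq`, `B5G183RateL2.bVec_sq_le` — all classes, centre included),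
    **`sum_sq_bRw_diff_le`** (`|bRw^{(RN)} − extP bRw^{(N)}|₂² ≤ d·Brate/N²`: `sum_sq_sub_extP`, paired
    classes `bVec_rate_sq_le` with `w1dSym_weight_hyps`, unpaired tail `bVec_unpaired_sq_le`);
 §3 **`opNorm_T_piece_W1_le`** (`≤ CTW1(d,a)/N`: `B5G183RatePieces.opNorm_rankOne_sub_rankOne_le` with
    the coefficient rate `B5G183Rate.cB_rate` and size `cB_le`), **`residualW1_le`** (the `W∂ ⊗ W∂`
    residual `≤ CW1op(d,a)/N`, all `N, R ≥ 1`, `a > 0`, `p′ ≠ 0`, `ν, ν′`) and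
    **`orderTwoOpRateResidualW1_holds d a : OrderTwoOpRateResidualW1 d a (CW1op d a) 1`** — the
    ONE-weight-per-derivative currency (King's own `u…ū` placement) has the FULL rate `γ = 1` at the
    operator level; together with `B5G183RateObstructionOp` (no rate with zero weights) and
    `B5G183RateO2Op` (rate with `W²` on one side) this settles order two of (1.89) fibrewise at `U = 1`.

WHAT REMAINS / NOT CLAIMED: exponent trade with FEWER than one weight per derivative (King: `α + γ < 1`);
`p′`-derivatives of the symbols, the `∫dp′` identification, Prop. 1.2 (1.110)–(1.111) p. 35 decay with a
rate, `U ≠ 1`, sharp constants; print states NO rate.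
-/

noncomputable section

namespace Literature.MathematicalPhysics.QuantumFieldTheory.Balaban1983to89.B5G183RateW1RankOne

open scoped BigOperators ComplexConjugate Matrix.Norms.L2Operator
open Finset Complex
open Literature.MathematicalPhysics.QuantumFieldTheory.Balaban1983to89.B4Strip
open Literature.MathematicalPhysics.QuantumFieldTheory.Balaban1983to89.B5Prop11Leaves
open Literature.MathematicalPhysics.QuantumFieldTheory.Balaban1983to89.B5Prop11Fiber
open Literature.MathematicalPhysics.QuantumFieldTheory.Balaban1983to89.B5Prop11Bound
open Literature.MathematicalPhysics.QuantumFieldTheory.Balaban1983to89.B5Hk163Rate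
open Literature.MathematicalPhysics.QuantumFieldTheory.Balaban1983to89.B5Hk163RateSum
open Literature.MathematicalPhysics.QuantumFieldTheory.Balaban1983to89.B5G183Rate
open Literature.MathematicalPhysics.QuantumFieldTheory.Balaban1983to89.B5G183RateSum
open Literature.MathematicalPhysics.QuantumFieldTheory.Balaban1983to89.B5G183RateL2
open Literature.MathematicalPhysics.QuantumFieldTheory.Balaban1983to89.B5G183RateOp
open Literature.MathematicalPhysics.QuantumFieldTheory.Balaban1983to89.B5G183RateO2Diag
open Literature.MathematicalPhysics.QuantumFieldTheory.Balaban1983to89.B5G183RateO2Op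
open Literature.MathematicalPhysics.QuantumFieldTheory.Balaban1983to89.B5G183RatePieces
open Literature.MathematicalPhysics.QuantumFieldTheory.Balaban1983to89.B5G183RateW1Diag
open Literature.MathematicalPhysics.QuantumFieldTheory.Balaban1983to89.B5G183RateW1BlockR
open Literature.MathematicalPhysics.QuantumFieldTheory.Balaban1983to89.B5G183RateW1BlockC
open Literature.MathematicalPhysics.QuantumFieldTheory.King1986

variable {d : ℕ}

/-! ## §1 The rank-one piece in regularised form [folklore] -/

section LevelN

variable {n : ℕ} [NeZero n]

/-- the regularised weighted bracket vector `(K, μ) ↦ w(K)·bR_μ(q̃_K)` (`bR = b/Δ₀`, b05/Bałaban (1.88)).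
[cite: Balaban1984PropagatorsI, (1.88) p.32] [folklore] -/
def bRw (n : ℕ) [NeZero n] (a : ℝ) (s : Fin d → ℝ) (w : (Fin d → Fin n) → ℂ)
    (I : (Fin d → Fin n) × Fin d) : ℂ :=
  w I.1 * bR n a I.2 (symmAlias n I.1 s) s

/-- **b05's rank-one piece of Bałaban's fibre in regularised form:** `cT·(wb) ⊗ (w′b)̄ = cB·bRw ⊗ bRw′̄`
(`B5G183Rate.fiber_rankOne_eq` at the symmetric representatives — «This factor … gives an inverse of the
expression (1.86)»). [cite: Balaban1984PropagatorsI, (1.83) p.31, (1.86)/(1.88) p.32] [folklore] -/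
theorem rankOne_bw_eq (hn : 1 ≤ n) (a : ℝ) (ha : 0 < a) {s : Fin d → ℝ} (hs : ∀ ν, |s ν| ≤ Real.pi)
    (hs0 : s ≠ 0) (w₁ w₂ : (Fin d → Fin n) → ℂ) :
    rankOne (balabanFiber n hn a ha s hs hs0).cT ((balabanFiber n hn a ha s hs hs0).bw w₁)
        ((balabanFiber n hn a ha s hs hs0).bw w₂)
      = rankOne ((cB n a s : ℝ) : ℂ) (bRw n a s w₁) (bRw n a s w₂) := by
  ext I J
  unfold rankOne Fiber.bw bRw
  have h := fiber_rankOne_eq hn a ha s hs hs0 (isRep_symmAlias hn I.1 hs) (isRep_symmAlias hn J.1 hs)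
    I.2 J.2
  rw [map_mul, map_mul]
  calc (balabanFiber n hn a ha s hs hs0).cT * (w₁ I.1 * (balabanFiber n hn a ha s hs hs0).b I.1 I.2)
        * (conj (w₂ J.1) * conj ((balabanFiber n hn a ha s hs hs0).b J.1 J.2))
      = w₁ I.1 * conj (w₂ J.1) * ((balabanFiber n hn a ha s hs hs0).cT
          * (balabanFiber n hn a ha s hs hs0).b I.1 I.2
          * conj ((balabanFiber n hn a ha s hs hs0).b J.1 J.2)) := by ring
    _ = w₁ I.1 * conj (w₂ J.1) * (((cB n a s : ℝ) : ℂ) * bR n a I.2 (symmAlias n I.1 s) s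
          * conj (bR n a J.2 (symmAlias n J.1 s) s)) := by rw [h]
    _ = _ := by ring

/-- the size constant of `|bRw|₂²` per `μ`: `π²(πM_rS)² + (CBa/π)²·CW`. [folklore] -/
def Bsq (d : ℕ) (a : ℝ) : ℝ := Real.pi ^ 2 * (Real.pi * MrS d a) ^ 2 + (CBa d / Real.pi) ^ 2 * CW d

omit [NeZero n] in
/-- `0 ≤ Bsq`. [folklore] -/
theorem Bsq_nonneg (d : ℕ) (a : ℝ) : 0 ≤ Bsq d a := by
  have hW := CW_nonneg d
  unfold Bsq; positivity

/-- **uniform size:** `|bRw(W∂_ν)|₂² ≤ d·Bsq` (`B5G183RateL2.bVec_sq_le`, all classes incl. the centre).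
[cite: Balaban1984PropagatorsI, (1.88) p.32; King1986, (4.20) p.672] [folklore] -/
theorem sum_sq_bRw_le (hn : 1 ≤ n) (a : ℝ) (ha : 0 < a) {s : Fin d → ℝ} (hs : ∀ ν, |s ν| ≤ Real.pi)
    (hs0 : s ≠ 0) (ν : Fin d) :
    ∑ I, ‖bRw n a s (fun K => w1dSym n K s ν) I‖ ^ 2 ≤ d * Bsq d a := by
  obtain ⟨ν₀, hν₀⟩ : ∃ ν, s ν ≠ 0 := Function.ne_iff.mp hs0
  have hw : ∀ K : Fin d → Fin n, ‖w1dSym n K s ν‖ ≤ ‖symmAlias n K s‖ :=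
    (w1dSym_weight_hyps (N := n) (R := 1) hn le_rfl hs ν).1
  rw [Fintype.sum_prod_type, Finset.sum_comm]
  calc ∑ μ : Fin d, ∑ K : Fin d → Fin n, ‖bRw n a s (fun K => w1dSym n K s ν) (K, μ)‖ ^ 2
      ≤ ∑ _μ : Fin d, Bsq d a := Finset.sum_le_sum fun μ _ => by
        unfold bRw Bsq
        exact bVec_sq_le hn a ha hs ν₀ hν₀ μ hw
    _ = d * Bsq d a := by simp

/-- `|bRw|₂ ≤ √(d·Bsq)`. [folklore] -/
theorem l2n_bRw_le (hn : 1 ≤ n) (a : ℝ) (ha : 0 < a) {s : Fin d → ℝ} (hs : ∀ ν, |s ν| ≤ Real.pi)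
    (hs0 : s ≠ 0) (ν : Fin d) :
    l2n (bRw n a s (fun K => w1dSym n K s ν)) ≤ Real.sqrt (d * Bsq d a) := by
  refine l2n_le_of_sq_le (Real.sqrt_nonneg _) ?_
  rw [Real.sq_sqrt (by have := Bsq_nonneg d a; positivity)]
  exact sum_sq_bRw_le hn a ha hs hs0 ν

end LevelN

/-! ## §2 The `ℓ²` eta-rate of the regularised bracket vector [folklore] -/

section Rate

variable {N R : ℕ} [NeZero N] [NeZero R]

/-- the rate constant of `|bRw^{(RN)} − extP bRw^{(N)}|₂²` per `μ` (times `N⁻²`). [folklore] -/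
def Brate (d : ℕ) (a : ℝ) : ℝ := CbRate d a 6 + (CBa d / Real.pi) ^ 2 * CW d

omit [NeZero N] [NeZero R] in
/-- `0 ≤ Brate`. [folklore] -/
theorem Brate_nonneg (d : ℕ) (a : ℝ) : 0 ≤ Brate d a := by
  have hW := CW_nonneg d
  unfold Brate CbRate; positivity

/-- `|extP bRw^{(N)}|₂ ≤ √(d·Bsq)`. [folklore] -/
theorem l2n_extP_bRw_le (hN : 1 ≤ N) (a : ℝ) (ha : 0 < a) {s : Fin d → ℝ}
    (hs : ∀ ν, |s ν| ≤ Real.pi) (hs0 : s ≠ 0) (ν : Fin d) :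
    l2n (extP R s (bRw N a s (fun k => w1dSym N k s ν))) ≤ Real.sqrt (d * Bsq d a) := by
  refine l2n_le_of_sq_le (Real.sqrt_nonneg _) ?_
  rw [Real.sq_sqrt (by have := Bsq_nonneg d a; positivity), sum_sq_extP hN hs]
  exact sum_sq_bRw_le hN a ha hs hs0 ν

/-- **squared `ℓ²` eta-rate of the regularised bracket vector:**
`Σ_I |bRw^{(RN)}(W∂^{(RN)}_ν)(I) − extP bRw^{(N)}(W∂^{(N)}_ν)(I)|² ≤ d·Brate/N²` — King's `m = 0` classes
through `bVec_rate_sq_le` (weight hypotheses `w1dSym_weight_hyps`), the `|m| ≥ 1` classes through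
`bVec_unpaired_sq_le`. [cite: King1986, (4.19)–(4.20), (4.23) p.672, (4.24) p.673; Balaban1984PropagatorsI,
(1.88) p.32] [folklore] -/
theorem sum_sq_bRw_diff_le (hN : 1 ≤ N) (hR : 1 ≤ R) (hRN : 1 ≤ R * N) (a : ℝ) (ha : 0 < a)
    {s : Fin d → ℝ} (hs : ∀ ν, |s ν| ≤ Real.pi) (hs0 : s ≠ 0) (ν : Fin d) :
    ∑ I, ‖bRw (R * N) a s (fun K => w1dSym (R * N) K s ν) I
        - extP R s (bRw N a s (fun k => w1dSym N k s ν)) I‖ ^ 2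
      ≤ d * Brate d a / (N : ℝ) ^ 2 := by
  obtain ⟨ν₀, hν₀⟩ : ∃ ν, s ν ≠ 0 := Function.ne_iff.mp hs0
  have hN0 : (0 : ℝ) < N := by exact_mod_cast hN
  have hwgt := w1dSym_weight_hyps (N := N) (R := R) hN hR hs ν
  have hw1 : ∀ K : Fin d → Fin (R * N), ‖w1dSym (R * N) K s ν‖ ≤ ‖symmAlias (R * N) K s‖ :=
    (w1dSym_weight_hyps (N := R * N) (R := 1) hRN le_rfl hs ν).1
  rw [sum_sq_sub_extP hN hs]
  have hpaired : ∑ k : Fin d → Fin N, ∑ μ : Fin d,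
      ‖bRw (R * N) a s (fun K => w1dSym (R * N) K s ν) (iota R k s, μ)
        - bRw N a s (fun k => w1dSym N k s ν) (k, μ)‖ ^ 2 ≤ d * (CbRate d a 6 / (N : ℝ) ^ 2) := by
    rw [Finset.sum_comm]
    calc ∑ μ : Fin d, ∑ k : Fin d → Fin N,
          ‖bRw (R * N) a s (fun K => w1dSym (R * N) K s ν) (iota R k s, μ)
            - bRw N a s (fun k => w1dSym N k s ν) (k, μ)‖ ^ 2
        ≤ ∑ _μ : Fin d, CbRate d a 6 / (N : ℝ) ^ 2 := Finset.sum_le_sum fun μ _ => by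
          refine le_of_eq_of_le (Finset.sum_congr rfl fun k _ => ?_)
            (bVec_rate_sq_le hN hR a ha hs ν₀ hν₀ μ (wN := fun k => w1dSym N k s ν)
              (wR := fun K => w1dSym (R * N) K s ν) (cw := 6) (by norm_num) hwgt.1 hwgt.2)
          unfold bRw
          rw [symmAlias_iota hN k hs, norm_sub_rev]
      _ = d * (CbRate d a 6 / (N : ℝ) ^ 2) := by simp
  have hunp : ∑ K ∈ Finset.univ.filter (fun K => ∀ k : Fin d → Fin N, iota R k s ≠ K), ∑ μ : Fin d,
      ‖bRw (R * N) a s (fun K => w1dSym (R * N) K s ν) (K, μ)‖ ^ 2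
        ≤ d * ((CBa d / (Real.pi * N)) ^ 2 * CW d) := by
    rw [Finset.sum_comm]
    calc ∑ μ : Fin d, ∑ K ∈ Finset.univ.filter (fun K => ∀ k : Fin d → Fin N, iota R k s ≠ K),
          ‖bRw (R * N) a s (fun K => w1dSym (R * N) K s ν) (K, μ)‖ ^ 2
        ≤ ∑ _μ : Fin d, (CBa d / (Real.pi * N)) ^ 2 * CW d := Finset.sum_le_sum fun μ _ => by
          unfold bRw
          exact bVec_unpaired_sq_le hN hR a ha hs ν₀ hν₀ μ hw1
      _ = d * ((CBa d / (Real.pi * N)) ^ 2 * CW d) := by simp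
  calc _ ≤ d * (CbRate d a 6 / (N : ℝ) ^ 2) + d * ((CBa d / (Real.pi * N)) ^ 2 * CW d) :=
        add_le_add hpaired hunp
    _ = d * Brate d a / (N : ℝ) ^ 2 := by unfold Brate; field_simp

/-- **`ℓ²` eta-rate of the regularised bracket vector:** `≤ √(d·Brate)/N`. [folklore] -/
theorem l2n_bRw_diff_le (hN : 1 ≤ N) (hR : 1 ≤ R) (hRN : 1 ≤ R * N) (a : ℝ) (ha : 0 < a)
    {s : Fin d → ℝ} (hs : ∀ ν, |s ν| ≤ Real.pi) (hs0 : s ≠ 0) (ν : Fin d) :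
    l2n (bRw (R * N) a s (fun K => w1dSym (R * N) K s ν)
        - extP R s (bRw N a s (fun k => w1dSym N k s ν)))
      ≤ Real.sqrt (d * Brate d a) / N := by
  have hN0 : (0 : ℝ) < N := by exact_mod_cast hN
  have hB : 0 ≤ (d : ℝ) * Brate d a := by have := Brate_nonneg d a; positivity
  refine l2n_le_of_sq_le (by positivity) ?_
  rw [div_pow, Real.sq_sqrt hB]
  have h := sum_sq_bRw_diff_le hN hR hRN a ha hs hs0 ν
  simp only [Pi.sub_apply] at h ⊢
  exact h

end Rate

/-! ## §3 The rank-one piece and the `W∂ ⊗ W∂` residual are `O(1/N)` [folklore] -/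

section Main

variable {N R : ℕ} [NeZero N] [NeZero R]

/-- constant of the rank-one piece: `ρ_B·d·Bsq + 2(4d+a)a⁻¹·√(dBrate)√(dBsq)`, `ρ_B = 4dC_φ/γ₀²`. [folklore] -/
def CTW1 (d : ℕ) (a : ℝ) : ℝ :=
  4 * d * B5ActionRate166.Cphi / T4GaugeActionRate.gam0 d ^ 2 * (d * Bsq d a)
    + 2 * ((4 * d + a) / a) * (Real.sqrt (d * Brate d a) * Real.sqrt (d * Bsq d a))

omit [NeZero N] [NeZero R] in
/-- `0 ≤ CTW1` for `0 < a`. [folklore] -/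
theorem CTW1_nonneg (d : ℕ) {a : ℝ} (ha : 0 < a) : 0 ≤ CTW1 d a := by
  have hC := B5ActionRate166.Cphi_pos
  have hg := T4GaugeActionRate.gam0_pos d
  have hB := Bsq_nonneg d a
  unfold CTW1; positivity

/-- **THE RANK-ONE PIECE `T` OF THE `W∂_ν ⊗ W∂_{ν′}` ORDER-TWO eta-RATE IS `O(1/N)`:**
`‖cT^{(RN)}(W∂b)⊗(W∂b)̄ − rankOne cT^{(N)} (extP (W∂b)^{(N)}) (extP (W∂b)^{(N)})‖ ≤ CTW1(d,a)/N` — regularised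
form `rankOne_bw_eq` + `plant_rankOne`, then the trilinear split `opNorm_rankOne_sub_rankOne_le` with
the coefficient rate `B5G183Rate.cB_rate` (`4dC_φγ₀⁻²/N²`), the size `cB_le` (`≤ (4d+a)/a`), and §2.
[cite: Balaban1984PropagatorsI, (1.83) p.31, (1.86)/(1.88) p.32, Prop. 1.1 (1.89) p.33; King1986,
(4.19)–(4.20) p.672, (4.24) p.673] [folklore] -/
theorem opNorm_T_piece_W1_le (hN : 1 ≤ N) (hR : 1 ≤ R) (hRN : 1 ≤ R * N) (a : ℝ) (ha : 0 < a)
    {s : Fin d → ℝ} (hs : ∀ ν, |s ν| ≤ Real.pi) (hs0 : s ≠ 0) (ν ν' : Fin d) :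
    ‖rankOne (balabanFiber (R * N) hRN a ha s hs hs0).cT
          ((balabanFiber (R * N) hRN a ha s hs hs0).bw fun K => w1dSym (R * N) K s ν)
          ((balabanFiber (R * N) hRN a ha s hs hs0).bw fun K => w1dSym (R * N) K s ν')
        - rankOne (balabanFiber N hN a ha s hs hs0).cT
          (extP R s ((balabanFiber N hN a ha s hs hs0).bw fun k => w1dSym N k s ν))
          (extP R s ((balabanFiber N hN a ha s hs hs0).bw fun k => w1dSym N k s ν'))‖
      ≤ CTW1 d a / N := by
  obtain ⟨ν₀, hν₀⟩ : ∃ ν, s ν ≠ 0 := Function.ne_iff.mp hs0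
  have hN0 : (0 : ℝ) < N := by exact_mod_cast hN
  have hN1 : (1 : ℝ) ≤ N := by exact_mod_cast hN
  have hC := B5ActionRate166.Cphi_pos
  have hg := T4GaugeActionRate.gam0_pos d
  have hBsq := Bsq_nonneg d a
  have hBr := Brate_nonneg d a
  rw [← plant_rankOne, rankOne_bw_eq hRN a ha hs hs0, rankOne_bw_eq hN a ha hs hs0, plant_rankOne]
  -- coefficient facts
  have hcbR := cB_pos hRN a ha hs ν₀ hν₀
  have hcbN := cB_pos hN a ha hs ν₀ hν₀
  have hcle := cB_le hN a ha hs ν₀ hν₀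
  have hrate := cB_rate (N := N) (R := R) hN hR a ha hs ν₀ hν₀
  have hdiff : ‖((cB (R * N) a s : ℝ) : ℂ) - ((cB N a s : ℝ) : ℂ)‖
      ≤ 4 * d * B5ActionRate166.Cphi / T4GaugeActionRate.gam0 d ^ 2 / (N : ℝ) ^ 2 := by
    rw [← Complex.ofReal_sub, Complex.norm_real, Real.norm_eq_abs, abs_sub_comm]
    calc |cB N a s - cB (R * N) a s|
        ≤ 4 * d * B5ActionRate166.Cphi / T4GaugeActionRate.gam0 d ^ 2 * ((N : ℝ) ^ 2)⁻¹ := hrate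
      _ = _ := by ring
  have hnN : ‖((cB N a s : ℝ) : ℂ)‖ ≤ (4 * d + a) / a := by
    rw [Complex.norm_real, Real.norm_eq_abs, abs_of_pos hcbN]
    exact hcle.1.trans hcle.2
  -- vector facts
  set S := Real.sqrt (d * Bsq d a) with hS
  set Sr := Real.sqrt (d * Brate d a) with hSr
  have hS0 : 0 ≤ S := Real.sqrt_nonneg _
  have hSr0 : 0 ≤ Sr := Real.sqrt_nonneg _
  have hx := l2n_bRw_le hRN a ha hs hs0 ν
  have hy := l2n_bRw_le hRN a ha hs hs0 ν'
  have hx' := l2n_extP_bRw_le (R := R) hN a ha hs hs0 ν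
  have hdx := l2n_bRw_diff_le hN hR hRN a ha hs hs0 ν
  have hdy := l2n_bRw_diff_le hN hR hRN a ha hs hs0 ν'
  have key := opNorm_rankOne_sub_rankOne_le ((cB (R * N) a s : ℝ) : ℂ) ((cB N a s : ℝ) : ℂ)
    (bRw (R * N) a s fun K => w1dSym (R * N) K s ν) (extP R s (bRw N a s fun k => w1dSym N k s ν))
    (bRw (R * N) a s fun K => w1dSym (R * N) K s ν') (extP R s (bRw N a s fun k => w1dSym N k s ν'))
    (K₁ := 4 * d * B5ActionRate166.Cphi / T4GaugeActionRate.gam0 d ^ 2 / (N : ℝ) ^ 2 * (S * S))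
    (K₂ := (4 * d + a) / a * (Sr / N * S)) (K₃ := (4 * d + a) / a * (S * (Sr / N)))
    (by positivity) (by positivity) (by positivity)
    (mul_le_mul hdiff (mul_le_mul hx hy (l2n_nonneg _) hS0)
      (mul_nonneg (l2n_nonneg _) (l2n_nonneg _)) (by positivity))
    (mul_le_mul hnN (mul_le_mul hdx hy (l2n_nonneg _) (by positivity))
      (mul_nonneg (l2n_nonneg _) (l2n_nonneg _)) (by positivity))
    (mul_le_mul hnN (mul_le_mul hx' hdy (l2n_nonneg _) hS0)
      (mul_nonneg (l2n_nonneg _) (l2n_nonneg _)) (by positivity))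
  refine key.trans ?_
  have hSS : S * S = d * Bsq d a := Real.mul_self_sqrt (by positivity)
  rw [hSS]
  have h2 : 4 * d * B5ActionRate166.Cphi / T4GaugeActionRate.gam0 d ^ 2 / (N : ℝ) ^ 2 * (d * Bsq d a)
      ≤ 4 * d * B5ActionRate166.Cphi / T4GaugeActionRate.gam0 d ^ 2 / N * (d * Bsq d a) := by
    have : 4 * d * B5ActionRate166.Cphi / T4GaugeActionRate.gam0 d ^ 2 / (N : ℝ) ^ 2
        ≤ 4 * d * B5ActionRate166.Cphi / T4GaugeActionRate.gam0 d ^ 2 / N :=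
      div_le_div_of_nonneg_left (by positivity) hN0 (by nlinarith)
    exact mul_le_mul_of_nonneg_right this (by positivity)
  calc 4 * d * B5ActionRate166.Cphi / T4GaugeActionRate.gam0 d ^ 2 / (N : ℝ) ^ 2 * (d * Bsq d a)
        + (4 * d + a) / a * (Sr / N * S) + (4 * d + a) / a * (S * (Sr / N))
      ≤ 4 * d * B5ActionRate166.Cphi / T4GaugeActionRate.gam0 d ^ 2 / N * (d * Bsq d a)
        + (4 * d + a) / a * (Sr / N * S) + (4 * d + a) / a * (S * (Sr / N)) := by gcongr
    _ = CTW1 d a / N := by unfold CTW1; rw [hS, hSr]; ring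

/-- the total constant of the `W∂ ⊗ W∂` order-two operator residual: `CdgW1 + CRW1 + 2CCW1 + CTW1`.
[folklore] -/
def CW1op (d : ℕ) (a : ℝ) : ℝ := CdgW1 d a + CRW1 d a + 2 * CCW1 d a + CTW1 d a

/-- **THE `W∂_ν ⊗ W∂_{ν′}` ORDER-TWO eta-RATE OF (1.83)/(1.89) AT `U = 1`, OPERATOR LEVEL:** for all
`N, R ≥ 1`, `a > 0`, `p′ ≠ 0`, `ν, ν′`,
`‖D_{W∂ν}F_{RN}D*_{W∂ν′} − plant_R(D_{W∂ν}F_N D*_{W∂ν′})‖ ≤ CW1op(d,a)/N` — the five pieces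
(`B5G183RateW1Diag`, `…W1BlockR`, `…W1BlockC`, `opNorm_T_piece_W1_le`). [cite: Balaban1984PropagatorsI,
Prop. 1.1 (1.89) p.33; King1986, (4.19)–(4.20) p.672, (4.24) p.673] [folklore] -/
theorem residualW1_le (hN : 1 ≤ N) (hR : 1 ≤ R) (hRN : 1 ≤ R * N) (a : ℝ) (ha : 0 < a)
    {s : Fin d → ℝ} (hs : ∀ ν, |s ν| ≤ Real.pi) (hs0 : s ≠ 0) (ν ν' : Fin d) :
    ‖sandwich (fun K => w1dSym (R * N) K s ν) (fun K => w1dSym (R * N) K s ν')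
          (balabanFiber (R * N) hRN a ha s hs hs0).G
        - plant R s (sandwich (fun k => w1dSym N k s ν) (fun k => w1dSym N k s ν')
          (balabanFiber N hN a ha s hs hs0).G)‖
      ≤ CW1op d a / N := by
  have h1 := residualW1_le_four_pieces_add_T (N := N) (R := R) hN hR hRN a ha hs hs0 ν ν'
  have h2 := opNorm_T_piece_W1_le hN hR hRN a ha hs hs0 ν ν'
  dsimp only at h1
  have e : CW1op d a / (N : ℝ) = (CdgW1 d a + CRW1 d a + 2 * CCW1 d a) / N + CTW1 d a / N := by
    unfold CW1op; ring
  rw [e]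
  linarith

/-- **`OrderTwoOpRateResidualW1 d a (CW1op d a) 1` HOLDS:** the ONE-King-weight-per-derivative currency
(King's own `u…ū` placement, (4.19)–(4.20)) carries the FULL eta-rate `γ = 1` of the order-two item
`‖∇G∇*J‖` of (1.89) at `U = 1`, fibrewise in the `ℓ²`-operator norm — the typed residual of
`B5G183RateO2Op` is closed. [cite: Balaban1984PropagatorsI, Prop. 1.1 (1.89) p.33; King1986, (4.19)–(4.20)
p.672] [folklore] -/
theorem orderTwoOpRateResidualW1_holds (d : ℕ) (a : ℝ) : OrderTwoOpRateResidualW1 d a (CW1op d a) 1 := by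
  intro N R _ _ hN hRN ha s hs hs0 ν ν' hR
  rw [Real.rpow_one]
  exact residualW1_le hN hR hRN a ha hs hs0 ν ν'

/-- **every exponent `γ ≤ 1`** (bookkeeping, `orderTwoOpRateResidualW1_mono`). [folklore] -/
theorem orderTwoOpRateResidualW1_of_le_one (d : ℕ) {a : ℝ} (ha : 0 < a) {γ : ℝ} (hγ : γ ≤ 1) :
    OrderTwoOpRateResidualW1 d a (CW1op d a) γ := by
  have hC : 0 ≤ CW1op d a := by
    have h1 := CdgW1_nonneg d ha
    have h2 := CRW1_nonneg d ha.le
    have h3 := CCW1_nonneg d ha.le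
    have h4 := CTW1_nonneg d ha
    unfold CW1op; positivity
  exact orderTwoOpRateResidualW1_mono hC hγ (orderTwoOpRateResidualW1_holds d a)

end Main

end Literature.MathematicalPhysics.QuantumFieldTheory.Balaban1983to89.B5G183RateW1RankOne
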